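import Mathlib
import Summits.Ventures.PercRepro2.Defs
import Summits.Ventures.PercRepro2.Graph
import Summits.Ventures.PercRepro2.OneColourSwitch
import Summits.Ventures.PercRepro2.RegionHubSign
import Summits.Ventures.PercRepro2.SideSwitch
import Summits.Ventures.PercRepro2.SideSwitchClosed
import Summits.Ventures.PercRepro2.SideSwitchComps
import Summits.Ventures.PercRepro2.SideSwitchFibre
import Summits.Ventures.PercRepro2.TermSwitchDefs
import Summits.Ventures.PercRepro2.TermSwitchFibre
import Summits.Ventures.PercRepro2.TermSwitchCompsFibre
import Summits.Ventures.PercRepro2.TermSwitchMono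
import Summits.Ventures.PercRepro2.TermSwitchReach

import Summits.Ventures.PercRepro2.M9OneSidedFibre
import Summits.Ventures.PercRepro2.M9OneSidedFibreM

/-!
# The one-sided characterisation with `T`-edges (blind cell PercRepro2, p3 g30, 2026-08-28;
`proofs/P3-HDR.md` §12)

`M9OneSidedFibre` / `M9OneSidedFibreM` assume no edge between two terminals.  Here `d` may be
adjacent to `r` (edges `d–r` of either colour; still no `r–s` and no `d–s` edge).  The joining
notion `joinsT` uses the edges inside `B ∪ {r, s, d}` that are NOT inside `{r, s, d}`, so a
`T`-edge never joins by itself; the `T`-edges are fixed along the fibre and contribute the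
constants `cK` («some `T`-edge is `Y`») and `cM` («some `T`-edge is `W`»):
`d ∈ K₂(ρ_T) ⟺ cK ∨ (an unswitched block joins)` (`mem_K2_assignC_iff_joinsT`) and
`d ∈ M₂(ρ_T) ⟺ cM ∨ (a switched block joins)` (`mem_M2_assignC_iff_joinsT`).  Own work; std
axioms.
-/

namespace Summit.Ventures.PercRepro2

namespace TermSwitch

open Finset Classical RegionHub OneColourSwitch SideSwitch

variable {V : Type*} {E : Type*}

section JoinsT

variable [Fintype V] [DecidableEq V] {ends : E → Sym2 V} {p q r s d : V}

/-- The configuration of `ρ` restricted to the edges inside `B ∪ {r, s, d}` that are not inside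
`{r, s, d}`. -/
noncomputable def inT (ends : E → Sym2 V) (r s d : V) (B : Finset V) (ρ : Config E) : Config E :=
  fun e => if e ∈ within ends ((↑B : Set V) ∪ {r, s, d}) ∧ e ∉ within ends ({r, s, d} : Set V)
    then ρ e else false

/-- A block **joins** `d` to `{r, s}` through block-mediated edges. -/
def joinsT (ends : E → Sym2 V) (r s d : V) (B : Finset V) (ρ : Config E) : Prop :=
  Conn ends (inT ends r s d B ρ) d r ∨ Conn ends (inT ends r s d B ρ) d s

/-- The joining blocks. -/
noncomputable def joinSetT (ends : E → Sym2 V) (r s d : V) (ρ : Config E) : Finset (Finset V) :=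
  (compsH ends ({r, s, d} : Set V) ρ).filter (fun B => joinsT ends r s d B ρ)

/-- «Some `T`-edge is `Y`». -/
def cK (ends : E → Sym2 V) (r s d : V) (ρ : Config E) : Prop :=
  ∃ e, (ends e = s(d, r) ∨ ends e = s(d, s)) ∧ ρ e = true

/-- «Some `T`-edge is `W`». -/
def cM (ends : E → Sym2 V) (r s d : V) (ρ : Config E) : Prop :=
  ∃ e, (ends e = s(d, r) ∨ ends e = s(d, s)) ∧ ρ e = false

/-- The hypotheses on the terminals: pairwise distinct, no `r–s` edge, no `d–s` edge. -/
structure TEdge (ends : E → Sym2 V) (r s d : V) : Prop where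
  rs : r ≠ s
  rd : r ≠ d
  sd : s ≠ d
  no_rs : ∀ e, ends e ≠ s(r, s)
  no_ds : ∀ e, ends e ≠ s(d, s)

omit [Fintype V] [DecidableEq V] in
/-- An open edge of `inT` is an edge of `ρ` inside `B ∪ {r, s, d}`, not inside `{r, s, d}`. -/
lemma inT_eq_true_iff {B : Finset V} {ρ : Config E} {e : E} :
    inT ends r s d B ρ e = true ↔
      (e ∈ within ends ((↑B : Set V) ∪ {r, s, d}) ∧ e ∉ within ends ({r, s, d} : Set V)) ∧
        ρ e = true := by
  unfold inT
  split_ifs with h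
  · exact ⟨fun h' => ⟨h, h'⟩, fun h' => h'.2⟩
  · exact ⟨fun h' => absurd h' (by decide), fun h' => absurd h'.1 h⟩

omit [Fintype V] [DecidableEq V] in
/-- An edge between two distinct terminals is a `T`-edge `d–r` (and lies inside `H`). -/
lemma terminal_edge_cases (hT : TEdge ends r s d) {e : E} {x y : V} (hends : ends e = s(x, y))
    (hne : x ≠ y) (hx : x ∈ ({r, s, d} : Set V)) (hy : y ∈ ({r, s, d} : Set V)) :
    ends e = s(d, r) := by
  simp only [Set.mem_insert_iff, Set.mem_singleton_iff] at hx hy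
  rcases hx with rfl | rfl | rfl <;> rcases hy with rfl | rfl | rfl
  · exact absurd rfl hne
  · exact absurd hends (hT.no_rs e)
  · rw [hends, Sym2.eq_swap]
  · exact absurd (by rw [hends, Sym2.eq_swap]) (hT.no_rs e)
  · exact absurd rfl hne
  · exact absurd (by rw [hends, Sym2.eq_swap]) (hT.no_ds e)
  · exact hends
  · exact absurd hends (hT.no_ds e)
  · exact absurd rfl hne

omit [Fintype V] [DecidableEq V] in
/-- An edge inside `{r, s, d}` between distinct vertices is not an `inT`-edge and is a `T`-edge. -/
lemma mem_within_H_of_terminals {e : E} {x y : V} (hends : ends e = s(x, y))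
    (hx : x ∈ ({r, s, d} : Set V)) (hy : y ∈ ({r, s, d} : Set V)) :
    e ∈ within ends ({r, s, d} : Set V) := ⟨x, hx, y, hy, hends⟩

end JoinsT

section ClaimsT

variable [Fintype V] [DecidableEq V] {ends : E → Sym2 V} {p q r s d : V}

/-- **`d ∈ K₂` after the switch iff a `Y` `T`-edge or an unswitched joining block.** -/
theorem mem_K2_assignC_iff_joinsT (hT : TEdge ends r s d) {ρ : Config E}
    (hρ : ∀ x ∈ MH ends ({r, s, d} : Set V) ρ, x ∈ ({r, s, d} : Set V))
    {T : Finset (Finset V)} (hTc : T ⊆ compsH ends ({r, s, d} : Set V) ρ) :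
    d ∈ K2 ends r s (assignC ends T ρ) ↔
      cK ends r s d ρ ∨ ∃ B ∈ compsH ends ({r, s, d} : Set V) ρ, B ∉ T ∧ joinsT ends r s d B ρ := by
  have hd : d ∈ ({r, s, d} : Set V) := d_mem_triple r s d
  have hr : r ∈ ({r, s, d} : Set V) := r_mem_triple r s d
  have hs : s ∈ ({r, s, d} : Set V) := s_mem_triple r s d
  constructor
  · intro hK
    by_contra hno
    simp only [not_or, not_exists, not_and] at hno
    obtain ⟨hcK, hno⟩ := hno
    -- the vertices reached from `d` inside unswitched blocks
    have key : ∀ v, v ∈ {x | x = d ∨ ∃ B ∈ compsH ends ({r, s, d} : Set V) ρ, B ∉ T ∧ x ∈ B ∧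
        Conn ends (inT ends r s d B ρ) d x} → ∀ y, (openGraph ends (assignC ends T ρ)).Adj v y →
        y ∈ {x | x = d ∨ ∃ B ∈ compsH ends ({r, s, d} : Set V) ρ, B ∉ T ∧ x ∈ B ∧
          Conn ends (inT ends r s d B ρ) d x} := by
      intro v hv y hvy
      obtain ⟨hne, e, he, hends⟩ := openGraph_adj.1 hvy
      rcases hv with hvd | ⟨B, hB, hBT, hvB, hvc⟩
      · -- from `d`
        rw [hvd] at hends hne
        by_cases hyH : y ∈ ({r, s, d} : Set V)
        · exfalso
          have hdr : ends e = s(d, r) := terminal_edge_cases hT hends hne hd hyH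
          have hρe : ρ e = true := by
            rw [← assignC_eq_of_notMem (T := T) (ρ := ρ) hends (term_notMem_unionT hTc hd)
              (term_notMem_unionT hTc hyH)]
            exact he
          exact hcK ⟨e, Or.inl hdr, hρe⟩
        by_cases hyS : y ∈ KH ends ({r, s, d} : Set V) ρ ∪ MH ends ({r, s, d} : Set V) ρ
        · have hyA : y ∈ A0H ends ({r, s, d} : Set V) ρ := mem_A0H.2 ⟨hyS, hyH⟩
          obtain ⟨B, hB, hyB⟩ := exists_block_of_mem_A0H hyA
          have hρe : ρ e = true := edge_term_sided_true hρ hends hd hyH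
          by_cases hBT : B ∈ T
          · exfalso
            have hyU : y ∈ unionT T := mem_unionT.2 ⟨B, hBT, hyB⟩
            rw [assignC_eq_not_of_mem hends (Or.inr hyU), hρe] at he
            exact absurd he (by decide)
          · refine Or.inr ⟨B, hB, hBT, hyB, conn_of_openAdj ⟨e, ?_, hends⟩⟩
            refine inT_eq_true_iff.2 ⟨⟨⟨d, Or.inr hd, y, Or.inl (Finset.mem_coe.2 hyB), hends⟩, ?_⟩, hρe⟩
            rintro ⟨c, hc, c', hc', hcc'⟩
            rw [hends] at hcc'
            rcases Sym2.eq_iff.1 hcc' with ⟨_, hyc'⟩ | ⟨_, hyc⟩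
            · exact hyH (hyc' ▸ hc')
            · exact hyH (hyc ▸ hc)
        · exfalso
          have hρe : ρ e = false :=
            edge_KH_out_false hends (mem_KH_iff.2 ⟨d, hd, conn_refl _ _ _⟩) (fun h => hyS (Or.inl h))
          rw [assignC_eq_of_notMem hends (term_notMem_unionT hTc hd) (out_notMem_unionT hTc hyS),
            hρe] at he
          exact absurd he (by decide)
      · -- from a vertex of an unswitched block `B`
        have hvU : v ∉ unionT T := notMem_unionT_of_mem_of_notMem hTc hB hBT hvB
        have hvA : v ∈ A0H ends ({r, s, d} : Set V) ρ := subset_A0H_of_mem_compsH hB hvB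
        by_cases hyH : y ∈ ({r, s, d} : Set V)
        · have hyU : y ∉ unionT T := term_notMem_unionT hTc hyH
          have hρe : ρ e = true := by
            rw [← assignC_eq_of_notMem (T := T) (ρ := ρ) hends hvU hyU]; exact he
          have hvH : v ∉ ({r, s, d} : Set V) := fun h => term_notMem_A0H h hvA
          have hc : Conn ends (inT ends r s d B ρ) d y := conn_trans hvc (conn_of_openAdj ⟨e,
            inT_eq_true_iff.2 ⟨⟨⟨v, Or.inl (Finset.mem_coe.2 hvB), y, Or.inr hyH, hends⟩, by
              rintro ⟨c, hc, c', hc', hcc'⟩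
              rw [hends] at hcc'
              rcases Sym2.eq_iff.1 hcc' with ⟨hvc, _⟩ | ⟨hvc', _⟩
              · exact hvH (hvc ▸ hc)
              · exact hvH (hvc' ▸ hc')⟩, hρe⟩, hends⟩)
          simp only [Set.mem_insert_iff, Set.mem_singleton_iff] at hyH
          rcases hyH with rfl | rfl | rfl
          · exact absurd (Or.inl hc) (hno B hB hBT)
          · exact absurd (Or.inr hc) (hno B hB hBT)
          · exact Or.inl rfl
        by_cases hyS : y ∈ KH ends ({r, s, d} : Set V) ρ ∪ MH ends ({r, s, d} : Set V) ρ
        · have hyA : y ∈ A0H ends ({r, s, d} : Set V) ρ := mem_A0H.2 ⟨hyS, hyH⟩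
          have hyB : y ∈ B := mem_of_adj_of_mem_compsH hB hends hvB hyA
          have hyU : y ∉ unionT T := notMem_unionT_of_mem_of_notMem hTc hB hBT hyB
          have hρe : ρ e = true := by
            rw [← assignC_eq_of_notMem (T := T) (ρ := ρ) hends hvU hyU]; exact he
          refine Or.inr ⟨B, hB, hBT, hyB, conn_trans hvc (conn_of_openAdj ⟨e, ?_, hends⟩)⟩
          have hvH : v ∉ ({r, s, d} : Set V) := fun h => term_notMem_A0H h hvA
          refine inT_eq_true_iff.2 ⟨⟨⟨v, Or.inl (Finset.mem_coe.2 hvB), y,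
            Or.inl (Finset.mem_coe.2 hyB), hends⟩, ?_⟩, hρe⟩
          rintro ⟨c, hc, c', hc', hcc'⟩
          rw [hends] at hcc'
          rcases Sym2.eq_iff.1 hcc' with ⟨hvc, _⟩ | ⟨hvc', _⟩
          · exact hvH (hvc ▸ hc)
          · exact hvH (hvc' ▸ hc')
        · exfalso
          have hρe : ρ e = false :=
            edge_KH_out_false hends (mem_KH_of_mem_A0H hρ hvA) (fun h => hyS (Or.inl h))
          rw [assignC_eq_of_notMem hends hvU (out_notMem_unionT hTc hyS), hρe] at he
          exact absurd he (by decide)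
    have hrZ : r ∉ {x | x = d ∨ ∃ B ∈ compsH ends ({r, s, d} : Set V) ρ, B ∉ T ∧ x ∈ B ∧
        Conn ends (inT ends r s d B ρ) d x} := by
      rintro (h | ⟨B, hB, _, hrB, _⟩)
      · exact hT.rd h
      · exact term_notMem_A0H hr (subset_A0H_of_mem_compsH hB hrB)
    have hsZ : s ∉ {x | x = d ∨ ∃ B ∈ compsH ends ({r, s, d} : Set V) ρ, B ∉ T ∧ x ∈ B ∧
        Conn ends (inT ends r s d B ρ) d x} := by
      rintro (h | ⟨B, hB, _, hsB, _⟩)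
      · exact hT.sd h
      · exact term_notMem_A0H hs (subset_A0H_of_mem_compsH hB hsB)
    rcases mem_K2_iff.1 hK with hc | hc
    · exact hrZ (mem_of_conn_of_closed key (Or.inl rfl) (conn_symm hc))
    · exact hsZ (mem_of_conn_of_closed key (Or.inl rfl) (conn_symm hc))
  · rintro (⟨e, hde, hρe⟩ | ⟨B, hB, hBT, hj⟩)
    · -- a `Y` `T`-edge: `d` is `Y`-adjacent to `r` or `s`, and `T`-edges are never flipped
      have hU : ∀ t ∈ ({r, s, d} : Set V), t ∉ unionT T := fun t ht => term_notMem_unionT hTc ht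
      rcases hde with hde | hde
      · have he' : assignC ends T ρ e = true := by
          rw [assignC_eq_of_notMem hde (hU d hd) (hU r hr)]; exact hρe
        exact mem_K2_iff.2 (Or.inl (conn_symm (conn_of_openAdj ⟨e, he', hde⟩)))
      · have he' : assignC ends T ρ e = true := by
          rw [assignC_eq_of_notMem hde (hU d hd) (hU s hs)]; exact hρe
        exact mem_K2_iff.2 (Or.inr (conn_symm (conn_of_openAdj ⟨e, he', hde⟩)))
    -- a `Y`-path inside `B ∪ H` survives the switch of the other blocks
    have htr : ∀ {a b : V}, Conn ends (inT ends r s d B ρ) a b → Conn ends (assignC ends T ρ) a b := by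
      intro a b hab
      have key : ∀ v, v ∈ {x | Conn ends (assignC ends T ρ) a x} → ∀ y,
          (openGraph ends (inT ends r s d B ρ)).Adj v y →
            y ∈ {x | Conn ends (assignC ends T ρ) a x} := by
        intro v hv y hvy
        obtain ⟨_, e, he, hends⟩ := openGraph_adj.1 hvy
        obtain ⟨⟨⟨c, hc, c', hc', hcc'⟩, _⟩, hρe⟩ := inT_eq_true_iff.1 he
        have hnot : ∀ z, z ∈ (↑B : Set V) ∪ ({r, s, d} : Set V) → z ∉ unionT T := by
          intro z hz
          rcases hz with hz | hz
          · exact notMem_unionT_of_mem_of_notMem hTc hB hBT (Finset.mem_coe.1 hz)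
          · exact term_notMem_unionT hTc hz
        have he' : assignC ends T ρ e = true := by
          rw [hends] at hcc'
          rcases Sym2.eq_iff.1 hcc' with ⟨hvc, hyc'⟩ | ⟨hvc', hyc⟩
          · rw [assignC_eq_of_notMem hends (hvc ▸ hnot c hc) (hyc' ▸ hnot c' hc')]; exact hρe
          · rw [assignC_eq_of_notMem hends (hvc' ▸ hnot c' hc') (hyc ▸ hnot c hc)]; exact hρe
        exact conn_trans hv (conn_of_openAdj ⟨e, he', hends⟩)
      exact mem_of_conn_of_closed key (conn_refl _ _ _) hab
    rcases hj with hj | hj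
    · exact mem_K2_iff.2 (Or.inl (conn_symm (htr hj)))
    · exact mem_K2_iff.2 (Or.inr (conn_symm (htr hj)))



end ClaimsT

end TermSwitch

end Summit.Ventures.PercRepro2
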